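import Summits.QuantumAdvantage.AdviceFreeQNC0.WinTransport
import Summits.QuantumAdvantage.AdviceFreeQNC0.StructuredBound
import Summits.QuantumAdvantage.AdviceFreeQNC0.BlockParityWin
import Mathlib.Data.Finset.Powerset
import HarnessLib

/-!
# Cell qa-qnc0 (rung F-Q2-odd, `p = 3`): the WIN event on the structured inputs — Smolensky's endgame for B-shot strategies

Planner qa-qnc0-p1 g16, `ROUND-15.md` §3.6 (a)–(d), for THEOREM A `BShotDWB3`.  Weight-`1` gauge, structured pattern
`S c = Sx y c` (`StructuredBound.lean`), trimmed transported bells `w̃ ∘ Ψ_r`: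

* `dk3_Sx_nonInner` — at every non-inner cut the structured stake is `t₀^k(y) + η^k(y)·σ(c)` with the COMMON
  `σ(c) = Σ_j (−1)^{p_j(c)}` (`= BlockParity.target 0 1 c`) and `η^k ≠ 0`;
* `esymm` / `sum_esymm_eq` — (b) LOW DEGREE from sparsity: for `0/1` polynomials `g_k` (degree `≤ d`) of which at most
  `B` fire, `Σ_{j ≤ B} e_j(g) = (−1)^{#firing}` pointwise, so the parity of the firing count in a set `K_s` is the
  polynomial `Q_s = 2 − 2·Σ_{j≤B} e_j` of degree `≤ 2Bd`... (`Qpoly`, `Qpoly_eq_one_iff`);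
* (a) `chargePair`: at most two of `Q_0, Q_1, Q_2` fire (`card_Q_le_two`);
* **`card_win_structured_le`**: `#{c : WIN_{w̃∘Ψ_r}(S c)} ≤ 2^{Kℓ}·(2/3 + (4/3)2^{−K} + 6·2^K·(4BΔL)/√ℓ)`
  (`BlockParity.sum_three_le`), provided every `Ψ_r(S c)` rings at most `B` bells.

WHAT THIS IS NOT: the accounting/parameters are the next file; separation NOT moved.
-/

noncomputable section

namespace Summit.QuantumAdvantage.AdviceFreeQNC0

namespace DWalk

open Finset Equiv
open Literature.Computability.MetaComplexity Literature.Computability.MetaComplexity.Smolensky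

section StructuredWin

variable {n a L m K ℓ Lf : ℕ}

/-! ### The structured stake at every non-inner cut -/

/-- At a non-inner cut `k` the structured stake is `t + η·σ(c)` with `η ≠ 0`, `σ(c) = BlockParity.target 0 1 c`. -/
theorem dk3_Sx_nonInner (haW : a + (m + 1) * L ≤ n) {k : ℕ} (hk : k ≤ n) (hkni : k ≤ a ∨ a + (m + 1) * L ≤ k)
    (hW : (m + 1) * L = K * (6 * ℓ + 1) + Lf) {fb : Fin Lf → Bool} {b : Bool} {τ : ZMod 3}
    (hfb : fb ∈ fib (1 : ZMod 3) Lf (affP b τ)) (y : Fin (n + 1) → Bool) :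
    ∃ t η : ZMod 3, η ≠ 0 ∧ ∀ c : Fin (K * ℓ) → Bool,
      Dk3 (Sx a L m K ℓ fb y c) k = t + η * BlockParity.target 0 (fun _ => (1 : ZMod 3)) c := by
  obtain ⟨κc, hκc⟩ : ∃ κc : ZMod 3, κc ≠ 0 ∧ ∀ i, a ≤ i → i < a + (m + 1) * L → kappa k i = κc := by
    rcases hkni with h | h
    · exact ⟨1, one_ne_zero, fun i hi _ => by unfold kappa; rw [if_neg (by omega)]⟩
    · exact ⟨2, by decide, fun i _ hi => by unfold kappa; rw [if_pos (by omega)]⟩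
  set e := sgnW (xN y) 0 a with he
  refine ⟨trW (kappa k) (xN y) 0 a + e * (κc * τ + yt b * trW (kappa k) (xN y) (a + (m + 1) * L)
      (n - (a + (m + 1) * L))), e * κc, ?_, fun c => ?_⟩
  · rcases sgnW_eq_or (xN y) 0 a with h | h <;> rw [he, h]
    · simpa using hκc.1
    · have : ∀ z : ZMod 3, z ≠ 0 → -1 * z ≠ 0 := by decide
      exact this _ hκc.1
  set x := Sx a L m K ℓ fb y c with hx
  rw [dk3_eq_trW x hk, trW_window (kappa k) (xN x) haW]
  have hout : ∀ i, ¬ (a ≤ i ∧ i < a + (m + 1) * L) → xN x i = xN y i := fun i hi => xN_glue_of_not_mem y _ hi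
  have h1 : trW (kappa k) (xN x) 0 a = trW (kappa k) (xN y) 0 a :=
    trW_congr fun t ht => ⟨rfl, by rw [Nat.zero_add]; exact hout t (by omega)⟩
  have h2 : sgnW (xN x) 0 a = e := sgnW_congr fun t ht => by rw [Nat.zero_add]; exact hout t (by omega)
  have h3 : trW (kappa k) (xN x) (a + (m + 1) * L) (n - (a + (m + 1) * L)) =
      trW (kappa k) (xN y) (a + (m + 1) * L) (n - (a + (m + 1) * L)) := trW_congr fun t _ => ⟨rfl, hout _ (by omega)⟩
  have hwin := isAff_Pwin_Sx (κ₀ := 1) (kappaConst_one a L m) haW hW hfb y c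
  rw [Pwin_eq_wp (kappaConst_one a L m)] at hwin
  have hu := (isAff_wp (kappa 0) (xN x) a ((m + 1) * L)).unique hwin
  rw [trW_kappa_window 1 (kappaConst_one a L m) (xN x), one_mul] at hu
  rw [trW_kappa_window κc hκc.2 (xN x), h1, h2, h3, hu.1, hu.2]
  unfold BlockParity.target BlockParity.tau
  rw [← Fin.sum_univ_eq_sum_range (fun j => gsign ℓ (cbOf K ℓ c j)) K]
  simp only [gsign_cbOf, one_mul, zero_add]
  ring

/-! ### (b) Elementary symmetric polynomials of 0/1 polynomials -/

/-- `e_j(g)` over an index set `Ks`. -/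
def esymm {ι : Type*} [DecidableEq ι] (Ks : Finset ι) (g : ι → CubeFn (ZMod 3) (K * ℓ)) (j : ℕ) :
    CubeFn (ZMod 3) (K * ℓ) := ∑ S ∈ Ks.powersetCard j, ∏ k ∈ S, g k

/-- `e_j` has degree `≤ j·d`. -/
theorem esymm_mem_lowDeg {ι : Type*} [DecidableEq ι] (Ks : Finset ι) {g : ι → CubeFn (ZMod 3) (K * ℓ)} {d : ℕ}
    (hg : ∀ k ∈ Ks, g k ∈ lowDeg (ZMod 3) (K * ℓ) d) (j : ℕ) : esymm Ks g j ∈ lowDeg (ZMod 3) (K * ℓ) (j * d) := by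
  unfold esymm
  refine Submodule.sum_mem _ fun S hS => ?_
  have hS' := Finset.mem_powersetCard.1 hS
  have := prod_mem_lowDeg S (u := g) (D := d) fun k hk => hg k (hS'.1 hk)
  rwa [hS'.2] at this

/-- Pointwise, `e_j(g)(c) = C(#{k ∈ Ks : g_k(c) = 1}, j)` for `0/1`-valued `g`. -/
theorem esymm_apply {ι : Type*} [DecidableEq ι] (Ks : Finset ι) {g : ι → CubeFn (ZMod 3) (K * ℓ)}
    (hg01 : ∀ k c, g k c = 0 ∨ g k c = 1) (j : ℕ) (c : Fin (K * ℓ) → Bool) :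
    esymm Ks g j c = ((Ks.filter fun k => g k c = 1).card.choose j : ℕ) := by
  unfold esymm
  rw [Finset.sum_apply]
  have hterm : ∀ S ∈ Ks.powersetCard j, (∏ k ∈ S, g k) c = if S ⊆ Ks.filter (fun k => g k c = 1) then 1 else 0 := by
    intro S hS
    rw [Finset.prod_apply]
    split_ifs with h
    · exact Finset.prod_eq_one fun k hk => (Finset.mem_filter.1 (h hk)).2
    · have hnot : ¬ ∀ k ∈ S, g k c = 1 := fun hall =>
        h fun k hk => Finset.mem_filter.2 ⟨(Finset.mem_powersetCard.1 hS).1 hk, hall k hk⟩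
      obtain ⟨k, hk⟩ := not_forall.mp hnot
      have hkS : k ∈ S := by
        by_contra h'
        exact hk fun h'' => absurd h'' h'
      have hk' : g k c ≠ 1 := fun h'' => hk fun _ => h''
      exact Finset.prod_eq_zero hkS ((hg01 k c).resolve_right hk')
  rw [Finset.sum_congr rfl hterm, Finset.sum_boole, ← Finset.card_powersetCard]
  congr 2
  ext S
  simp only [mem_filter, Finset.mem_powersetCard]
  constructor
  · rintro ⟨⟨_, hc⟩, hsub⟩; exact ⟨hsub, hc⟩
  · rintro ⟨hsub, hc⟩; exact ⟨⟨fun k hk => (Finset.mem_filter.1 (hsub hk)).1, hc⟩, hsub⟩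

/-- **Sparsity gives low degree**: if at most `B` of the `g_k` fire at `c`, then
`Σ_{j ≤ B} e_j(g)(c) = (−1)^{#firing in Ks}` (`2 = −1` in `𝔽₃`, binomial theorem). -/
theorem sum_esymm_eq {ι : Type*} [DecidableEq ι] (Ks : Finset ι) {g : ι → CubeFn (ZMod 3) (K * ℓ)}
    (hg01 : ∀ k c, g k c = 0 ∨ g k c = 1) {B : ℕ} (c : Fin (K * ℓ) → Bool)
    (hB : (Ks.filter fun k => g k c = 1).card ≤ B) :
    ∑ j ∈ range (B + 1), esymm Ks g j c = (-1) ^ (Ks.filter fun k => g k c = 1).card := by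
  simp only [esymm_apply Ks hg01]
  have h1 : ∑ j ∈ range (B + 1), (((Ks.filter fun k => g k c = 1).card.choose j : ℕ) : ZMod 3) =
      ∑ j ∈ range ((Ks.filter fun k => g k c = 1).card + 1),
        (((Ks.filter fun k => g k c = 1).card.choose j : ℕ) : ZMod 3) := by
    rw [← Finset.sum_subset (Finset.range_mono (Nat.succ_le_succ hB))]
    intro j hj hj'
    have h1 := Finset.mem_range.1 hj
    have h2 : ¬ j < (Ks.filter fun k => g k c = 1).card + 1 := fun h => hj' (Finset.mem_range.2 h)
    rw [Nat.choose_eq_zero_of_lt (by omega)]; simp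
  rw [h1, ← Nat.cast_sum, Nat.sum_range_choose]
  push_cast
  rw [show (2 : ZMod 3) = -1 by decide]

/-- The parity polynomial of the firing count in `Ks`: `Q = 2 − 2·Σ_{j≤B} e_j`. -/
def Qpoly {ι : Type*} [DecidableEq ι] (Ks : Finset ι) (g : ι → CubeFn (ZMod 3) (K * ℓ)) (B : ℕ) :
    CubeFn (ZMod 3) (K * ℓ) := (2 : ZMod 3) • (1 - ∑ j ∈ range (B + 1), esymm Ks g j)

/-- `Q` has degree `≤ B·d`. -/
theorem Qpoly_mem_lowDeg {ι : Type*} [DecidableEq ι] (Ks : Finset ι) {g : ι → CubeFn (ZMod 3) (K * ℓ)} {d : ℕ}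
    (hg : ∀ k ∈ Ks, g k ∈ lowDeg (ZMod 3) (K * ℓ) d) (B : ℕ) : Qpoly Ks g B ∈ lowDeg (ZMod 3) (K * ℓ) (B * d) := by
  unfold Qpoly
  refine Submodule.smul_mem _ _ (Submodule.sub_mem _ (one_mem_lowDeg _) (Submodule.sum_mem _ fun j hj => ?_))
  exact lowDeg_mono (Nat.mul_le_mul_right _ (by have := Finset.mem_range.1 hj; omega)) (esymm_mem_lowDeg Ks hg j)

/-- **`Q(c) = 1 ↔` an odd number of the `g_k`, `k ∈ Ks`, fire at `c`** (when at most `B` fire in total). -/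
theorem Qpoly_eq_one_iff {ι : Type*} [DecidableEq ι] (Ks : Finset ι) {g : ι → CubeFn (ZMod 3) (K * ℓ)}
    (hg01 : ∀ k c, g k c = 0 ∨ g k c = 1) {B : ℕ} (c : Fin (K * ℓ) → Bool)
    (hB : (Ks.filter fun k => g k c = 1).card ≤ B) :
    Qpoly Ks g B c = 1 ↔ (Ks.filter fun k => g k c = 1).card % 2 = 1 := by
  unfold Qpoly
  simp only [Pi.smul_apply, Pi.sub_apply, Pi.one_apply, Finset.sum_apply, smul_eq_mul]
  rw [sum_esymm_eq Ks hg01 c hB]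
  rcases Nat.even_or_odd (Ks.filter fun k => g k c = 1).card with h | h
  · rw [h.neg_one_pow, Nat.even_iff.1 h]
    constructor
    · intro h'; exact absurd h' (by decide)
    · intro h'; exact absurd h' (by decide)
  · rw [h.neg_one_pow, Nat.odd_iff.1 h]
    constructor
    · intro _; rfl
    · intro _; decide

/-! ### (a) At most two of the three parities fire -/

/-- **`chargePair`** in this language: if each `k` is excluded from exactly one of the three index sets and the firing
set is common, at most two of the three firing counts are odd. -/
theorem card_odd_le_two {ι : Type*} [DecidableEq ι] (R : Finset ι) (Ks : ZMod 3 → Finset ι)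
    (hK : ∀ k ∈ R, (univ.filter fun s : ZMod 3 => k ∈ Ks s).card = 2) :
    (univ.filter fun s : ZMod 3 => (R.filter fun k => k ∈ Ks s).card % 2 = 1).card ≤ 2 := by
  -- the three counts sum to `2·#R`, an even number
  have hsum : ∑ s : ZMod 3, (R.filter fun k => k ∈ Ks s).card = 2 * R.card := by
    simp only [Finset.card_filter]
    rw [Finset.sum_comm]
    simp only [← Finset.card_filter]
    rw [Finset.sum_congr rfl hK, sum_const, smul_eq_mul, mul_comm]
  by_contra h3
  have hall : (univ.filter fun s : ZMod 3 => (R.filter fun k => k ∈ Ks s).card % 2 = 1) = univ := by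
    apply Finset.eq_univ_of_card
    have := Finset.card_le_univ (univ.filter fun s : ZMod 3 => (R.filter fun k => k ∈ Ks s).card % 2 = 1)
    rw [ZMod.card] at this ⊢; omega
  have hodd : ∀ s : ZMod 3, (R.filter fun k => k ∈ Ks s).card % 2 = 1 := fun s => by
    have := Finset.mem_univ s; rw [← hall, mem_filter] at this; exact this.2
  have h0 := hodd 0; have h1 := hodd 1; have h2 := hodd 2
  have hsum' : (R.filter fun k => k ∈ Ks 0).card + (R.filter fun k => k ∈ Ks 1).card +
      (R.filter fun k => k ∈ Ks 2).card = 2 * R.card := by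
    rw [← hsum]
    rw [show (univ : Finset (ZMod 3)) = {0, 1, 2} from by decide]
    rw [Finset.sum_insert (by decide), Finset.sum_insert (by decide), Finset.sum_singleton]; ring
  omega

/-! ### The structured WIN count -/

/-- **Structured endgame for WIN** (ROUND-15 §3.6): for the trimmed transported bells `w̃ ∘ Ψ_r` at the structured
inputs, if at most `B` bells ring at every `Ψ_r(S c)`, then
`#{c : WIN_{w̃∘Ψ_r}(S c)} ≤ 2^{Kℓ}·(2/3 + (4/3)2^{−K} + 6·2^K·(B·(2ΔL))/√ℓ)`. -/
theorem card_win_structured_le (haW : a + (m + 1) * L ≤ n) (hL : 1 ≤ L) (hℓ : 1 ≤ ℓ)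
    (hW : (m + 1) * L = K * (6 * ℓ + 1) + Lf) {fb : Fin Lf → Bool} {b : Bool} {τ : ZMod 3}
    (hfb : fb ∈ fib (1 : ZMod 3) Lf (affP b τ)) (y : Fin (n + 1) → Bool) {Δ : ℕ}
    {w : Fin (n + 1) → CubeFn (ZMod 3) (n + 1)} (hw : ∀ k, w k ∈ lowDeg (ZMod 3) (n + 1) Δ)
    (r : Rand L m (1 : ZMod 3)) {B : ℕ}
    (hB : ∀ c : Fin (K * ℓ) → Bool, (univ.filter fun k : Fin (n + 1) =>
      wtil a L m w k (psi a L m 1 r (Sx a L m K ℓ fb y c)) = 1).card ≤ B) :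
    ((univ.filter fun c : Fin (K * ℓ) → Bool =>
        WinOdd (fun k => fun z => wtil a L m w k (psi a L m 1 r z)) (Sx a L m K ℓ fb y c)).card : ℝ) ≤
      (2 : ℝ) ^ (K * ℓ) * (2 / 3 + 4 / 3 / (2 : ℝ) ^ K + 6 * (2 : ℝ) ^ K * ((B * (2 * (Δ * L)) : ℕ) : ℝ) / Real.sqrt ℓ) := by
  classical
  -- the 0/1 polynomials `g_k`
  set G : Fin (n + 1) → CubeFn (ZMod 3) (K * ℓ) := fun k c => wtil a L m w k (psi a L m 1 r (Sx a L m K ℓ fb y c))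
    with hG
  have hGdeg : ∀ k, G k ∈ lowDeg (ZMod 3) (K * ℓ) (Δ * L) := fun k =>
    comp_Sx_mem_lowDeg fb y (comp_psi_mem_lowDeg haW hL r (wtil_mem_lowDeg hw k))
  set g : Fin (n + 1) → CubeFn (ZMod 3) (K * ℓ) := fun k => BlockParity.indEq (G k) 1 with hg
  have hg01 : ∀ k c, g k c = 0 ∨ g k c = 1 := fun k c => by
    rw [hg]; dsimp only; rw [BlockParity.indEq_apply]; split_ifs <;> simp
  have hg1 : ∀ k c, g k c = 1 ↔ G k c = 1 := fun k c => by
    rw [hg]; dsimp only; rw [BlockParity.indEq_apply]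
    split_ifs with h <;> simp [h]
  have hgdeg : ∀ k, g k ∈ lowDeg (ZMod 3) (K * ℓ) (2 * (Δ * L)) := fun k => BlockParity.indEq_mem_lowDeg (hGdeg k) 1
  -- stakes at non-inner cuts: constants `t k`, `η k`
  have hstk : ∀ k : Fin (n + 1), ¬ Inner a L m k.val → ∃ t η : ZMod 3, η ≠ 0 ∧ ∀ c : Fin (K * ℓ) → Bool,
      Dk3 (Sx a L m K ℓ fb y c) k.val = t + η * BlockParity.target 0 (fun _ => (1 : ZMod 3)) c := fun k hk =>
    dk3_Sx_nonInner haW (by have := k.isLt; omega) (by unfold Inner at hk; omega) hW hfb y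
  choose! tk ηk hηk hDk using hstk
  -- index sets: non-inner cuts whose stake is `≠ 1` when `σ = s`
  set Ks : ZMod 3 → Finset (Fin (n + 1)) := fun s =>
    univ.filter fun k => ¬ Inner a L m k.val ∧ tk k + ηk k * s ≠ 1 with hKs
  -- the three parity polynomials
  set Q : ZMod 3 → CubeFn (ZMod 3) (K * ℓ) := fun s => Qpoly (Ks s) g B with hQ
  have hQdeg : ∀ s, Q s ∈ lowDeg (ZMod 3) (K * ℓ) (B * (2 * (Δ * L))) := fun s =>
    Qpoly_mem_lowDeg (Ks s) (fun k _ => hgdeg k) B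
  -- firing sets
  have hfire : ∀ c s, ((Ks s).filter fun k => g k c = 1).card ≤ B := by
    intro c s
    refine le_trans (Finset.card_le_card fun k hk => ?_) (hB c)
    rw [mem_filter] at hk ⊢
    exact ⟨mem_univ _, (hg1 k c).1 hk.2⟩
  have hQ1 : ∀ s c, Q s c = 1 ↔ ((Ks s).filter fun k => g k c = 1).card % 2 = 1 := fun s c =>
    Qpoly_eq_one_iff (Ks s) hg01 c (hfire c s)
  -- WIN at `S c` with `σ(c) = s` is `Q_s(c) = 1`
  have hwin : ∀ c, WinOdd (fun k => fun z => wtil a L m w k (psi a L m 1 r z)) (Sx a L m K ℓ fb y c) ↔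
      Q (BlockParity.target 0 (fun _ => (1 : ZMod 3)) c) c = 1 := by
    intro c
    rw [hQ1]
    unfold WinOdd
    have hset : (univ.filter fun k : Fin (n + 1) =>
        wtil a L m w k (psi a L m 1 r (Sx a L m K ℓ fb y c)) = 1 ∧ Dk3 (Sx a L m K ℓ fb y c) k.val ≠ 1) =
        (Ks (BlockParity.target 0 (fun _ => (1 : ZMod 3)) c)).filter fun k => g k c = 1 := by
      ext k
      simp only [mem_filter, mem_univ, true_and, hKs, hg1]
      constructor
      · rintro ⟨h1, hD⟩
        have hni : ¬ Inner a L m k.val := (wtil_eq_one_iff.1 h1).1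
        refine ⟨⟨hni, ?_⟩, h1⟩
        rwa [hDk k hni c] at hD
      · rintro ⟨⟨hni, hD⟩, h1⟩
        exact ⟨h1, by rwa [hDk k hni c]⟩
    rw [hset]
  -- charge pair
  have hcharge : ∀ c, (univ.filter fun s : ZMod 3 => Q s c = 1).card ≤ 2 := by
    intro c
    set R : Finset (Fin (n + 1)) := univ.filter fun k => ¬ Inner a L m k.val ∧ g k c = 1 with hR
    have hRK : ∀ s, (Ks s).filter (fun k => g k c = 1) = R.filter fun k => k ∈ Ks s := by
      intro s; ext k; simp only [mem_filter, mem_univ, true_and, hKs, hR]; tauto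
    have heq : (univ.filter fun s : ZMod 3 => Q s c = 1) =
        univ.filter fun s : ZMod 3 => (R.filter fun k => k ∈ Ks s).card % 2 = 1 := by
      ext s; simp only [mem_filter, mem_univ, true_and, hQ1, hRK]
    rw [heq]
    refine card_odd_le_two R Ks fun k hk => ?_
    rw [hR, mem_filter] at hk
    have hne := hηk k hk.2.1
    simp only [hKs, mem_filter, mem_univ, true_and, hk.2.1, not_false_eq_true]
    -- exactly one `s` solves `t + η s = 1`
    have key : ∀ t η : ZMod 3, η ≠ 0 → (univ.filter fun s : ZMod 3 => t + η * s ≠ 1).card = 2 := by decide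
    exact key _ _ hne
  -- conclude with LEMMA S for three hypotheses
  have hcount : ((univ.filter fun c : Fin (K * ℓ) → Bool =>
      WinOdd (fun k => fun z => wtil a L m w k (psi a L m 1 r z)) (Sx a L m K ℓ fb y c)).card : ℝ) =
      ∑ s : ZMod 3, ((univ.filter fun c : Fin (K * ℓ) → Bool =>
        Q s c = 1 ∧ BlockParity.target 0 (fun _ => (1 : ZMod 3)) c = s).card : ℝ) := by
    rw [← Nat.cast_sum, ← Finset.card_biUnion]
    · congr 2
      ext c
      simp only [mem_filter, mem_univ, true_and, Finset.mem_biUnion, hwin]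
      constructor
      · intro h; exact ⟨_, h, rfl⟩
      · rintro ⟨s, h, hs⟩; rwa [hs]
    · intro s _ s' _ hss'
      exact Finset.disjoint_filter.2 fun c _ h1 h2 => hss' (h1.2.symm.trans h2.2)
  rw [hcount]
  exact BlockParity.sum_three_le hℓ 0 (fun _ => 1) (fun _ => one_ne_zero) Q hQdeg hcharge

end StructuredWin

end DWalk

end Summit.QuantumAdvantage.AdviceFreeQNC0

end
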